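import Mathlib

/-!
# Lattice sums with a local density converge to the integral (chain lemma)
# (helper for `DensityIntegration`, item stmt-CriticalPhenomena-14890, route CardyBoundaryCoulombGas)

The discrete-to-continuum step of the density integration: if, along a chain of points
`v₀ⁿ < v₁ⁿ < ⋯ < v_Mⁿ` of `[s, s']` whose mesh tends to `0` and whose end points tend to `s` and
`s'`, masses `mₖⁿ` attached to the gaps have local density `g` — `mₖⁿ / (v_{k+1}ⁿ − vₖⁿ) − g(vₖⁿ) → 0`
uniformly in `k` — for a `g` continuous on `[s, s']`, then `Σₖ mₖⁿ → ∫_s^{s'} g`.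
Pure real analysis (uniform continuity of `g` on the compact interval and telescoping).
-/

noncomputable section

open Set Filter Topology MeasureTheory intervalIntegral Finset
open scoped Interval

namespace Summit.CriticalPhenomena.CardyFormulaZ2.Theorems

/-- Telescoping bound: if every gap of an increasing chain is weighted by at most `e`, the
weighted sum of the gaps is at most `e · (v M − v 0)`. [folklore] -/
theorem sum_le_mul_of_le_mul_gap {M : ℕ} {v : ℕ → ℝ} {f : ℕ → ℝ} {e : ℝ}
    (hf : ∀ k < M, f k ≤ e * (v (k + 1) - v k)) :
    ∑ k ∈ range M, f k ≤ e * (v M - v 0) := by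
  calc ∑ k ∈ range M, f k ≤ ∑ k ∈ range M, e * (v (k + 1) - v k) :=
        Finset.sum_le_sum fun k hk ↦ hf k (mem_range.1 hk)
    _ = e * (v M - v 0) := by rw [← Finset.mul_sum, Finset.sum_range_sub]

/-- **Chain lemma.** Masses with a uniform local density along a chain of mesh `→ 0` filling
`[s, s']` sum to the integral of the density. Hypotheses: `v n` strictly increasing on
`{0, …, M n}` with values in `[s, s']`, `v n 0 → s`, `v n (M n) → s'`, mesh `→ 0`, and
`sup_{k < M n} |m n k / (v n (k+1) - v n k) - g (v n k)| → 0`; `g` continuous on `[s, s']`.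
Conclusion: `∑_{k < M n} m n k → ∫_s^{s'} g`. [folklore] -/
theorem tendsto_sum_of_local_density {s s' : ℝ} (hss' : s ≤ s') {g : ℝ → ℝ}
    (hg : ContinuousOn g (Icc s s')) (M : ℕ → ℕ) (v m : ℕ → ℕ → ℝ)
    (hmem : ∀ n k, k ≤ M n → v n k ∈ Icc s s')
    (hmono : ∀ n k, k < M n → v n k < v n (k + 1))
    (h0 : Tendsto (fun n ↦ v n 0) atTop (𝓝 s))
    (hM : Tendsto (fun n ↦ v n (M n)) atTop (𝓝 s'))
    (hmesh : ∀ ε > 0, ∀ᶠ n in atTop, ∀ k < M n, v n (k + 1) - v n k ≤ ε)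
    (hdens : ∀ ε > 0, ∀ᶠ n in atTop, ∀ k < M n, |m n k / (v n (k + 1) - v n k) - g (v n k)| ≤ ε) :
    Tendsto (fun n ↦ ∑ k ∈ range (M n), m n k) atTop (𝓝 (∫ u in s..s', g u)) := by
  -- Step 0: `g` is bounded and uniformly continuous on `[s, s']`.
  have hcpt : IsCompact (Icc s s') := isCompact_Icc
  obtain ⟨G, hG⟩ : ∃ G, ∀ u ∈ Icc s s', |g u| ≤ G := by
    obtain ⟨G, hG⟩ := hcpt.exists_bound_of_continuousOn hg
    exact ⟨G, fun u hu ↦ by simpa [Real.norm_eq_abs] using hG u hu⟩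
  have hG0 : 0 ≤ G := (abs_nonneg _).trans (hG s (left_mem_Icc.2 hss'))
  have huc : UniformContinuousOn g (Icc s s') := hcpt.uniformContinuousOn_of_continuous hg
  have hii : ∀ x ∈ Icc s s', ∀ y ∈ Icc s s', IntervalIntegrable g volume x y := fun x hx y hy ↦
    (hg.mono (uIcc_subset_Icc hx hy)).intervalIntegrable
  rw [Metric.tendsto_atTop]
  intro ε hε
  set ℓ := s' - s with hℓ
  have hℓ0 : 0 ≤ ℓ := sub_nonneg.2 hss'
  set e := ε / (4 * (ℓ + 1)) with he
  have he0 : 0 < e := by positivity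
  obtain ⟨η, hη0, hη⟩ := Metric.uniformContinuousOn_iff.1 huc e he0
  have h3 : ∀ᶠ n in atTop, |v n 0 - s| < e / (G + 1) :=
    (Metric.tendsto_nhds.1 h0) _ (by positivity)
  have h4 : ∀ᶠ n in atTop, |v n (M n) - s'| < e / (G + 1) :=
    (Metric.tendsto_nhds.1 hM) _ (by positivity)
  obtain ⟨N, hN⟩ := eventually_atTop.1 ((hmesh (η / 2) (by positivity)).and
    ((hdens e he0).and (h3.and h4)))
  refine ⟨N, fun n hn ↦ ?_⟩
  obtain ⟨hn1, hn2, hn3, hn4⟩ := hN n hn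
  -- abbreviations for this `n`
  have hvmem : ∀ k, k ≤ M n → v n k ∈ Icc s s' := hmem n
  have hΔ : ∀ k < M n, 0 < v n (k + 1) - v n k := fun k hk ↦ sub_pos.2 (hmono n k hk)
  have hspan : v n (M n) - v n 0 ≤ ℓ := by
    have := (hvmem 0 (Nat.zero_le _)).1; have := (hvmem (M n) le_rfl).2; linarith
  -- A: masses versus density-weighted gaps
  have hA : |∑ k ∈ range (M n), m n k - ∑ k ∈ range (M n), g (v n k) * (v n (k + 1) - v n k)| ≤
      e * ℓ := by
    rw [← Finset.sum_sub_distrib]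
    refine (Finset.abs_sum_le_sum_abs _ _).trans ((sum_le_mul_of_le_mul_gap fun k hk ↦ ?_).trans
      (mul_le_mul_of_nonneg_left hspan he0.le))
    have hΔk := hΔ k hk
    have : m n k - g (v n k) * (v n (k + 1) - v n k) =
        (m n k / (v n (k + 1) - v n k) - g (v n k)) * (v n (k + 1) - v n k) := by
      field_simp
    rw [this, abs_mul, abs_of_pos hΔk]
    exact mul_le_mul_of_nonneg_right (hn2 k hk) hΔk.le
  -- B: density-weighted gaps versus the integral over the chain
  have hB : |∑ k ∈ range (M n), g (v n k) * (v n (k + 1) - v n k) -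
      ∫ u in v n 0..v n (M n), g u| ≤ e * ℓ := by
    rw [← intervalIntegral.sum_integral_adjacent_intervals (fun k hk ↦
      hii _ (hvmem k hk.le) _ (hvmem (k + 1) hk)), ← Finset.sum_sub_distrib]
    refine (Finset.abs_sum_le_sum_abs _ _).trans ((sum_le_mul_of_le_mul_gap fun k hk ↦ ?_).trans
      (mul_le_mul_of_nonneg_left hspan he0.le))
    have hΔk := hΔ k hk
    have hk1 := hvmem (k + 1) hk
    have hk0 := hvmem k hk.le
    -- `g (v k) Δ - ∫ g = ∫ (g (v k) - g u) du`
    have hsub : g (v n k) * (v n (k + 1) - v n k) - ∫ u in v n k..v n (k + 1), g u =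
        ∫ u in v n k..v n (k + 1), (g (v n k) - g u) := by
      rw [intervalIntegral.integral_sub intervalIntegrable_const (hii _ hk0 _ hk1),
        intervalIntegral.integral_const, smul_eq_mul, mul_comm]
    rw [hsub]
    have hbound : ∀ u ∈ Ι (v n k) (v n (k + 1)), ‖g (v n k) - g u‖ ≤ e := by
      intro u hu
      rw [uIoc_of_le (hmono n k hk).le] at hu
      have hu' : u ∈ Icc s s' := ⟨hk0.1.trans hu.1.le, hu.2.trans hk1.2⟩
      have hdist : dist (v n k) u < η := by
        rw [Real.dist_eq, abs_sub_comm, abs_of_pos (sub_pos.2 hu.1)]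
        linarith [hu.2, hn1 k hk]
      exact (le_of_lt (hη _ hk0 _ hu' hdist)).trans_eq' (by rw [Real.dist_eq, Real.norm_eq_abs])
    have := intervalIntegral.norm_integral_le_of_norm_le_const hbound
    rw [Real.norm_eq_abs, abs_of_pos hΔk] at this
    exact this
  -- C: the integral over the chain versus the integral over `[s, s']`
  have hC : |(∫ u in v n 0..v n (M n), g u) - ∫ u in s..s', g u| ≤ 2 * e := by
    have hs0 := hvmem 0 (Nat.zero_le _)
    have hsM := hvmem (M n) le_rfl
    have hsplit : ∫ u in s..s', g u = (∫ u in s..v n 0, g u) + ((∫ u in v n 0..v n (M n), g u) +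
        ∫ u in v n (M n)..s', g u) := by
      rw [intervalIntegral.integral_add_adjacent_intervals (hii _ hs0 _ hsM)
          (hii _ hsM _ (right_mem_Icc.2 hss')),
        intervalIntegral.integral_add_adjacent_intervals (hii _ (left_mem_Icc.2 hss') _ hs0)
          (hii _ hs0 _ (right_mem_Icc.2 hss'))]
    have hI1 : |∫ u in s..v n 0, g u| ≤ G * |v n 0 - s| := by
      have hb : ∀ u ∈ Ι s (v n 0), ‖g u‖ ≤ G := fun u hu ↦ by
        rw [Real.norm_eq_abs]
        exact hG u (uIoc_subset_uIcc.trans (uIcc_subset_Icc (left_mem_Icc.2 hss') hs0) hu)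
      simpa [Real.norm_eq_abs] using intervalIntegral.norm_integral_le_of_norm_le_const hb
    have hI2 : |∫ u in v n (M n)..s', g u| ≤ G * |s' - v n (M n)| := by
      have hb : ∀ u ∈ Ι (v n (M n)) s', ‖g u‖ ≤ G := fun u hu ↦ by
        rw [Real.norm_eq_abs]
        exact hG u (uIoc_subset_uIcc.trans (uIcc_subset_Icc hsM (right_mem_Icc.2 hss')) hu)
      simpa [Real.norm_eq_abs] using intervalIntegral.norm_integral_le_of_norm_le_const hb
    have hGe : G * (e / (G + 1)) ≤ e := by
      rw [mul_div_assoc']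
      exact (div_le_iff₀ (by positivity)).2 (by nlinarith [he0.le])
    have h3' : G * |v n 0 - s| ≤ e :=
      (mul_le_mul_of_nonneg_left hn3.le hG0).trans hGe
    have h4' : G * |s' - v n (M n)| ≤ e := by
      rw [abs_sub_comm]; exact (mul_le_mul_of_nonneg_left hn4.le hG0).trans hGe
    rw [hsplit]
    calc |(∫ u in v n 0..v n (M n), g u) - ((∫ u in s..v n 0, g u) +
          ((∫ u in v n 0..v n (M n), g u) + ∫ u in v n (M n)..s', g u))|
          = |(∫ u in s..v n 0, g u) + ∫ u in v n (M n)..s', g u| := by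
            rw [abs_sub_comm]; congr 1; ring
      _ ≤ |∫ u in s..v n 0, g u| + |∫ u in v n (M n)..s', g u| := abs_add_le _ _
      _ ≤ 2 * e := by linarith
  -- assemble
  rw [Real.dist_eq]
  have hεe : e * ℓ + e * ℓ + 2 * e < ε := by
    have : e * ℓ + e * ℓ + 2 * e = ε / 2 := by
      rw [he]; field_simp; ring
    linarith
  have t1 := abs_sub_le (∑ k ∈ range (M n), m n k)
    (∑ k ∈ range (M n), g (v n k) * (v n (k + 1) - v n k)) (∫ u in s..s', g u)
  have t2 := abs_sub_le (∑ k ∈ range (M n), g (v n k) * (v n (k + 1) - v n k))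
    (∫ u in v n 0..v n (M n), g u) (∫ u in s..s', g u)
  linarith

end Summit.CriticalPhenomena.CardyFormulaZ2.Theorems

end
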